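import Summits.FinalStateConjecture.FinalStateConjecture.Theorems.PhaseMixingCaptureWeakCosmicCensorshipMGHDStubScriTransfer
import Summits.FinalStateConjecture.FinalStateConjecture.Theorems.SwallowTheDatumKerrShieldedSettlesStubScriTransportAux
import Summits.FinalStateConjecture.FinalStateConjecture.Theorems.SwallowTheDatumKerrShieldedSettlesStubKerrLeafSojournAux2
import Summits.FinalStateConjecture.FinalStateConjecture.Theorems.SwallowTheDatumKerrShieldedSettlesStubKerrLeafSojournAux3
import Summits.FinalStateConjecture.FinalStateConjecture.Theses.PhaseMixingCapture
import Literature.Geometry.Lorentzian.CausalCurveLift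
import Literature.Geometry.Lorentzian.GeodesicLiftContinuation
import Literature.Geometry.Lorentzian.GeodesicMaximalFlow
import Literature.Geometry.Lorentzian.CommonDevelopmentEmbedding
import Literature.Geometry.Lorentzian.KerrDataProofs
import HarnessLib

/-!
# Crux `PhaseMixingCapture.WeakCosmicCensorshipMGHD` (stmt-FinalStateConjecture-9952), line
# `scri-transfer-third-of-burial`, stub `stub_farSojournTransfer` (plumbing adapter)

**Far-origin sojourn completeness of the realised development from the chart optics.**  Let the
datum `D` on `X` be Kerr-shielded by `(M, a, r₁, φ, ψ, ν)` and let `(𝒦, j)` be a realisation of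
the exterior sub-datum `φ^* D` inside exact Kerr: `𝒦` a vacuum Cauchy development of `φ^* D` and
`j : 𝒦 → Kerr.region a r₁` a smooth, time-orientation preserving, isometric open embedding over
the bent leaf (`j ∘ ι_𝒦 = ψ`, `dj ν_𝒦 = ν`) whose range contains the tapered collar
`W = {0 < x⁰ − T(r) + (r − r₁)/4}`.  Granted the sojourn optics of the chart seen from the bent
leaf (the conclusion of the sibling stub `stub_kerrLeafSojourn`, taken as a hypothesis): there is
`R₀` such that for every `s > 0` there is `R₁` such that every normalised future null ray of `𝒦`
from a leaf point of radius `≥ R₁` is future complete (`¬ BddAbove dom`) or sojourns affine time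
`≥ s` in `J⁺_𝒦(ι_𝒦{r ≤ R₀})`.

Proof (plumbing over three engines):

* maximal `𝒦`-rays are pieces of maximal chart rays through `j`
  (`exists_isMaximalGeodesicOn_lift`, landed with `stub_scriTransfer`; uniqueness of maximal
  geodesics), and the lift covers the whole forward piece of the chart ray inside `range j`
  (`IsMaximalGeodesicOn.mem_of_forall_exists_lift`, `Literature/…/GeodesicLiftContinuation`);
* chart rays from the far leaf are future causal curves (`KerrLeafSojourn.energy_pos_le_five`,
  `KerrLeafSojourn.ray_isFutureCausalCurveOn`, landed with `stub_kerrLeafSojourn`) and future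
  causal chart curves issuing from the leaf stay in the collar `W ⊆ range j` because the clock
  `u = x⁰ − T(r)` increases along them (`ScriTransport.curve_mem_collar`, support file of the
  sibling crux's stub `stub_scriTransport`);
* causal chart curves inside `range j` pull back along `j⁻¹` to causal curves of `𝒦`
  (`LorentzianMetric.invFun_mem_causalFuture`, `Literature/…/CausalCurveLift`; `j` is a local
  diffeomorphism by the inverse function theorem,
  `LorentzianMetric.isLocalDiffeomorph_of_isIsometricImmersion`), so the chart sojourn set is
  contained in the `𝒦`-sojourn set (`measure_mono`).

References: D. Christodoulou, CQG 16 (1999) A23, pp. A26–A27; M. Dafermos, I. Rodnianski,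
arXiv:0811.0354, §2.6.2 and §5.1; B. O'Neill, *Semi-Riemannian geometry* (1983), Ch. 3,
Prop. 3.24 and pp. 90–91, Ch. 14, p. 402.
-/

-- lint debt: the summit and the problem are both named `FinalStateConjecture` (tree layout)
set_option linter.dupNamespace false

noncomputable section

open scoped Manifold ContDiff Topology
open Set Function Filter Topology Literature.Geometry.Lorentzian
open Summit.FinalStateConjecture.FinalStateConjecture.Theorems.KerrShieldedDataExist.Negative
  (bentHeight graph coe_graph psi_eq_graph)
open Summit.FinalStateConjecture.FinalStateConjecture.Theorems.SwallowTheDatum.KerrShieldedSettles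
  (CollarCauchy.velocity_eq_deriv ScriTransport.curve_mem_collar
    KerrLeafSojourn.ray_isFutureCausalCurveOn KerrLeafSojourn.energy_pos_le_five)

namespace Summit.FinalStateConjecture.FinalStateConjecture.Theorems.PhaseMixingCapture.WeakCosmicCensorshipMGHD

/-! ## Two small Kerr-side facts -/

/-- The Kerr–Schild slices are connected spaces (theorem `Kerr.isConnected_slice_holds`); used as a
local instance, needed to speak of developments of data on the slice. [folklore] -/
private theorem connectedSpace_kerrSlice (a r₀ : ℝ) : ConnectedSpace (Kerr.slice a r₀) :=
  isConnected_iff_connectedSpace.mp (Kerr.isConnected_slice_holds a r₀)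

attribute [local instance] connectedSpace_kerrSlice

/-- `T(r) ≤ x⁰` on the bent leaf `ψ = graph M a r₁` (indeed `x⁰ = T(r)` there: the radius of a
chart point only depends on its spatial part), the form consumed by
`ScriTransport.curve_mem_collar`. [folklore] -/
private theorem bentHeight_le_graph_zero (M a r₁ : ℝ) (y : Kerr.slice a r₁) :
    bentHeight M a (Kerr.radius a ((graph M a r₁ y : Kerr.region a r₁) : E4)) ≤
      ((graph M a r₁ y : Kerr.region a r₁) : E4) 0 := by
  rw [coe_graph, E4.ofTimeSpace_apply_zero,
    Kerr.radius_ofTimeSpace a (bentHeight M a (Kerr.radius a (E4.ofTimeSpace 0 (y : E3)))) (y : E3)]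

/-! ## The registered stub -/

/-- **Stub `stub_farSojournTransfer` — far-origin sojourn completeness of the realised development
from the chart optics** (line `scri-transfer-third-of-burial` of crux
`stmt-FinalStateConjecture-9952`; plumbing adapter).  For a Kerr-shielded datum (first hypothesis,
unfolded), a vacuum Cauchy development `𝒦` of the exterior sub-datum `φ^* D` realised in the
exact Kerr chart by a smooth, time-orientation preserving, isometric open embedding `j` over the
bent leaf (`j ∘ ι_𝒦 = ψ`, `dj ν_𝒦 = ν`) whose range contains the tapered collar
`{0 < x⁰ − T(r) + (r − r₁)/4}` (second hypothesis, unfolded), and granted the sojourn optics of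
the chart seen from the bent leaf (third hypothesis): `𝒦` has complete future null infinity in the sojourn form as seen from the far leaf
origins, with the SAME reference radius `R₀` and the threshold `R₁` of the optics enlarged to
`max R₁ (16M + |a| + 1)`.  Proof.  A maximal normalised `𝒦`-ray `γ : dom` from `ι_𝒦 y` has
push-forward data `(ψ y, L = dj γ̇(0))`, null, future-directed and normalised (`j` isometric and
time-orientation preserving, `dj ν_𝒦 = ν`); the maximal chart geodesic `γ_K : dom_K` with these
data is a normalised null ray of the chart from `y`, and its maximal lift through `ι_𝒦 y`
(`exists_isMaximalGeodesicOn_lift`) is `γ` itself (uniqueness of maximal geodesics, O'Neill 1983,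
Ch. 3, Prop. 3.24), so `dom ⊆ dom_K` and `j ∘ γ = γ_K` on `dom`.  The chart ray is a future causal
curve (Killing energy `E > 0` from the far leaf, `energy_pos_le_five`, `ray_isFutureCausalCurveOn`)
issuing from the leaf, so it stays in the collar (`ScriTransport.curve_mem_collar`: the clock
`u = x⁰ − T(r)` increases along future causal curves), inside `range j`; hence
`[0, ∞) ∩ dom_K ⊆ dom` (`IsMaximalGeodesicOn.mem_of_forall_exists_lift`), and chart
completeness `[0, ∞) ⊆ dom_K` gives `¬ BddAbove dom`.  For the sojourn, a chart causal curve from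
`ψ y'` to `γ_K t` stays in the collar (same clock) and pulls back along `j⁻¹` to a causal curve
of `𝒦` from `ι_𝒦 y'` to `γ t` (`LorentzianMetric.invFun_mem_causalFuture`; `j` is a local
diffeomorphism by the inverse function theorem,
`LorentzianMetric.isLocalDiffeomorph_of_isIsometricImmersion`), so the chart sojourn set of `γ_K`
is contained in that of `γ` and `measure_mono` concludes.  Christodoulou, CQG 16 (1999) A23,
pp. A26–A27; O'Neill 1983, Ch. 3, Prop. 3.24 and pp. 90–91, Ch. 14, p. 402.
[cite: ONeillSemiRiemannian1983, Ch. 3, Prop. 24] -/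
theorem stub_farSojournTransfer : ∀ [Kerr.Facts] (X : Type) [TopologicalSpace X] [ChartedSpace E3 X]
    [IsManifold (𝓡 3) ∞ X] [T2Space X] [SecondCountableTopology X] [ConnectedSpace X]
    (D : InitialDataSet (𝓡 3) X) (M a r₁ : ℝ) (hM : 0 ≤ M) (φ : Kerr.slice a r₁ → X)
    (ψ : Kerr.slice a r₁ → Kerr.region a r₁) (ν : NormalField 𝓘(ℝ, E4) ψ), (|a| < M ∧
    Kerr.rMinus M a < r₁ ∧ r₁ < Kerr.rPlus M a ∧ IsCompact (Set.range φ)ᶜ ∧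
    Topology.IsOpenEmbedding φ ∧ ContMDiff 𝓘(ℝ, E3) (𝓡 3) ∞ φ ∧ (∀ y : Kerr.slice a r₁, (ψ y : E4) =
    E4.ofTimeSpace (bentHeight M a (Kerr.radius a (E4.ofTimeSpace 0 (y : E3)))) (y : E3)) ∧
    (Kerr.smoothMetric M a r₁).IsSpacelikeImmersion 𝓘(ℝ, E3) ψ ∧
    (Kerr.smoothMetric M a r₁).IsFutureUnitNormal 𝓘(ℝ, E3) ((Kerr.timeOrientation M a r₁ hM).ofLE
    le_top) ψ ν ∧ (∀ y : Kerr.slice a r₁, pullbackBilin (I := 𝓡 3) (I' := 𝓘(ℝ, E3)) φ D.h.inner y =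
    pullbackBilin (I := 𝓘(ℝ, E4)) (I' := 𝓘(ℝ, E3)) ψ (Kerr.smoothMetric M a r₁).val y) ∧
    (∀ [(Kerr.smoothMetric M a r₁).HasLeviCivita] (y : Kerr.slice a r₁),
    (pullbackBilin (I := 𝓡 3) (I' := 𝓘(ℝ, E3)) φ D.k y).toLinearMap₁₂ =
    (Kerr.smoothMetric M a r₁).secondFundamentalForm 𝓘(ℝ, E3) ψ ν y)) →
    ∀ (hΦ : ContMDiff (𝓡 3) (𝓡 3) (∞ + 1) φ)
    (hΦ' : ∀ u, Function.Injective (mfderiv (𝓡 3) (𝓡 3) φ u))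
    (𝒦 : VacuumCauchyDevelopment (D.comap φ hΦ hΦ')) (j : 𝒦.carrier → Kerr.region a r₁),
    (ContMDiff (𝓡 4) 𝓘(ℝ, E4) ∞ j ∧ Topology.IsOpenEmbedding j ∧
    𝒦.metric.IsIsometricImmersion (Kerr.smoothMetric M a r₁).toPseudoRiemannianMetric j ∧
    𝒦.timeOrientation.PreservesTimeOrientation j ((Kerr.timeOrientation M a r₁ hM).ofLE le_top) ∧
    j ∘ 𝒦.embed = ψ ∧
    (∀ y : Kerr.slice a r₁, mfderiv (𝓡 4) 𝓘(ℝ, E4) j (𝒦.embed y) (𝒦.normal y) = ν y) ∧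
    {x : Kerr.region a r₁ | 0 < (x : E4) 0 - bentHeight M a (Kerr.radius a (x : E4)) +
    (Kerr.radius a (x : E4) - r₁) / 4} ⊆ Set.range j) →
    (∀ [(Kerr.smoothMetric M a r₁).HasLeviCivita], ∃ R₀ : ℝ, ∀ s : ℝ, 0 < s → ∃ R₁ : ℝ,
    ∀ y : Kerr.slice a r₁, R₁ ≤ Kerr.radius a (E4.ofTimeSpace 0 (y : E3)) →
    ∀ (γ : ℝ → Kerr.region a r₁) (dom : Set ℝ),
    (Kerr.smoothMetric M a r₁).IsNormalisedNullRayFrom ((Kerr.timeOrientation M a r₁ hM).ofLE le_top)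
    ψ ν y γ dom → Set.Ici (0 : ℝ) ⊆ dom ∨ ENNReal.ofReal s ≤ sojournTime γ dom
    ((Kerr.smoothMetric M a r₁).causalFuture ((Kerr.timeOrientation M a r₁ hM).ofLE le_top)
    (ψ '' {y' : Kerr.slice a r₁ | Kerr.radius a (E4.ofTimeSpace 0 (y' : E3)) ≤ R₀}))) →
    ∀ [𝒦.metric.HasLeviCivita], ∃ R₀ : ℝ, ∀ s : ℝ, 0 < s → ∃ R₁ : ℝ, ∀ y : Kerr.slice a r₁,
    R₁ ≤ Kerr.radius a (E4.ofTimeSpace 0 (y : E3)) → ∀ (γ : ℝ → 𝒦.carrier) (dom : Set ℝ),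
    𝒦.metric.IsNormalisedNullRayFrom 𝒦.timeOrientation 𝒦.embed 𝒦.normal y γ dom →
    ¬ BddAbove dom ∨ ENNReal.ofReal s ≤ sojournTime γ dom
    (𝒦.metric.causalFuture 𝒦.timeOrientation
    (𝒦.embed '' {y' : Kerr.slice a r₁ | Kerr.radius a (E4.ofTimeSpace 0 (y' : E3)) ≤ R₀})) := by
  intro _ X _ _ _ _ _ _ D M a r₁ hM φ ψ ν hS hΦ hΦ' 𝒦 j hreal H inst𝒦
  obtain ⟨ha, -, -, -, -, -, hψ, -, hν, -, -⟩ := hS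
  obtain ⟨hjs, hjo, hiso, hτ, hjι, hjν, hW⟩ := hreal
  obtain rfl : ψ = graph M a r₁ := psi_eq_graph rfl hψ
  -- the chart metric has its Levi-Civita connection; both connections are `C¹`
  haveI instK : (Kerr.smoothMetric M a r₁).HasLeviCivita :=
    (Kerr.smoothMetric M a r₁).toPseudoRiemannianMetric.hasLeviCivita
  have h2 : ((1 : ℕ∞) : ℕ∞ω) + 1 ≤ ∞ := by
    rw [show ((1 : ℕ∞) : ℕ∞ω) + 1 = 2 by norm_num]; exact WithTop.coe_le_coe.2 le_top
  haveI : CovariantDerivative.ContMDiffCovariantDerivative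
      (Kerr.smoothMetric M a r₁).toPseudoRiemannianMetric.leviCivita 1 :=
    ⟨(Kerr.smoothMetric M a r₁).toPseudoRiemannianMetric.isLocallyContMDiff_leviCivita_holds 1 h2
      univ isOpen_univ⟩
  haveI : CovariantDerivative.ContMDiffCovariantDerivative
      𝒦.metric.toPseudoRiemannianMetric.leviCivita 1 :=
    ⟨𝒦.metric.toPseudoRiemannianMetric.isLocallyContMDiff_leviCivita_holds 1 h2 univ isOpen_univ⟩
  -- `dj` preserves scalar products, hence is injective; `j` is an injective local diffeomorphism
  have hval : ∀ (x : 𝒦.carrier) (u u' : TangentSpace (𝓡 4) x), 𝒦.metric.val x u u' =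
      (Kerr.smoothMetric M a r₁).val (j x) (mfderiv (𝓡 4) 𝓘(ℝ, E4) j x u)
        (mfderiv (𝓡 4) 𝓘(ℝ, E4) j x u') :=
    fun x u u' ↦ by
      have h := congrArg (fun b ↦ b u u') (hiso.2 x)
      simpa only [pullbackBilin_apply] using h.symm
  have hj' : ∀ x, Injective (mfderiv (𝓡 4) 𝓘(ℝ, E4) j x) := fun x ↦ by
    refine (injective_iff_map_eq_zero _).2 fun u hu ↦ 𝒦.metric.nondegenerate x u fun u' ↦ ?_
    rw [hval, hu, map_zero]
    rfl
  have hdim : Module.finrank ℝ (EuclideanSpace ℝ (Fin 4)) = Module.finrank ℝ E4 := rfl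
  have hj1 : ContMDiff (𝓡 4) 𝓘(ℝ, E4) (∞ + 1) j := hjs
  have hjinj : Injective j := hjo.injective
  have hloc : IsLocalDiffeomorph (𝓡 4) 𝓘(ℝ, E4) ∞ j :=
    LorentzianMetric.isLocalDiffeomorph_of_isIsometricImmersion hiso
  -- the optics of the chart, used at the far radius `max R₁ (16M + |a| + 1)`
  obtain ⟨R₀, hR₀⟩ := H
  refine ⟨R₀, fun s hs ↦ ?_⟩
  obtain ⟨R₁, hR₁⟩ := hR₀ s hs
  refine ⟨max R₁ (16 * M + |a| + 1), fun y hy γ dom hγ ↦ ?_⟩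
  haveI : Nonempty 𝒦.carrier := ⟨𝒦.embed y⟩
  have hyR₁ : R₁ ≤ Kerr.radius a (E4.ofTimeSpace 0 (y : E3)) := (le_max_left _ _).trans hy
  have hy16 : 16 * M + |a| + 1 ≤ ‖(y : E3)‖ :=
    ((le_max_right _ _).trans hy).trans
      ((Kerr.radius_le_spatialNorm a _).trans_eq (E4.spatialNorm_ofTimeSpace 0 _))
  -- data of the `𝒦`-ray
  have hmax := hγ.isMaximalGeodesicOn
  have hγ0 : γ 0 = 𝒦.embed y := hγ.apply_zero
  have hjy : j (𝒦.embed y) = graph M a r₁ y := congrFun hjι y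
  -- the maximal chart geodesic with data `(ψ y, dj γ̇(0))`; its maximal lift is `γ` itself
  obtain ⟨γK, domK, hKmax, h0K, hK0, hKv, -⟩ :=
    exists_isMaximalGeodesicOn
      (cov := (Kerr.smoothMetric M a r₁).toPseudoRiemannianMetric.leviCivita) (graph M a r₁ y)
      (mfderiv (𝓡 4) 𝓘(ℝ, E4) j (𝒦.embed y) (velocity (𝓡 4) γ 0))
  have hq : j (𝒦.embed y) = γK 0 := hjy.trans hK0.symm
  obtain ⟨γ', dom', hmax', h0', hγ'0, hγ'v, hdom', hagree'⟩ :=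
    exists_isMaximalGeodesicOn_lift (g := (Kerr.smoothMetric M a r₁).toPseudoRiemannianMetric)
      (g' := 𝒦.metric.toPseudoRiemannianMetric) hj1 hj' hdim hiso.2 hKmax h0K hq hKv.symm
  obtain ⟨Γ, S, hΓmax, -, -, -, hΓr⟩ :=
    exists_isMaximalGeodesicOn (cov := 𝒦.metric.toPseudoRiemannianMetric.leviCivita) (𝒦.embed y)
      (velocity (𝓡 4) γ 0)
  obtain ⟨hdomS, hγΓ⟩ := hΓr γ dom hmax.isOpen hmax.2.1 hγ.zero_mem hmax.isGeodesicOn hγ0 rfl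
  have hSdom : S = dom := hmax.2.2.2 Γ S hΓmax.isOpen hΓmax.2.1 hdomS hΓmax.isGeodesicOn hγΓ
  obtain ⟨hdom'S, hγ'Γ⟩ := hΓr γ' dom' hmax'.isOpen hmax'.2.1 h0' hmax'.isGeodesicOn hγ'0 hγ'v
  have hSdom' : S = dom' := hmax'.2.2.2 Γ S hΓmax.isOpen hΓmax.2.1 hdom'S hΓmax.isGeodesicOn hγ'Γ
  have hdd : dom = dom' := hSdom.symm.trans hSdom'
  have hagree : ∀ t ∈ dom, j (γ t) = γK t := fun t ht ↦ by
    rw [hγΓ ht, ← hγ'Γ (hdd ▸ ht)]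
    exact hagree' t (hdd ▸ ht)
  -- the push-forward data are null, future-directed and normalised
  have hLnull : Kerr.bilin M a (graph M a r₁ y)
      (mfderiv (𝓡 4) 𝓘(ℝ, E4) j (𝒦.embed y) (velocity (𝓡 4) γ 0))
      (mfderiv (𝓡 4) 𝓘(ℝ, E4) j (𝒦.embed y) (velocity (𝓡 4) γ 0)) = 0 := by
    have h0 : (Kerr.smoothMetric M a r₁).val (j (𝒦.embed y))
        (mfderiv (𝓡 4) 𝓘(ℝ, E4) j (𝒦.embed y) (velocity (𝓡 4) γ 0))
        (mfderiv (𝓡 4) 𝓘(ℝ, E4) j (𝒦.embed y) (velocity (𝓡 4) γ 0)) = 0 := by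
      rw [← hval]
      have key : ∀ (x : 𝒦.carrier) (_ : x = γ 0), 𝒦.metric.val x
          (show TangentSpace (𝓡 4) x from velocity (𝓡 4) γ 0)
          (show TangentSpace (𝓡 4) x from velocity (𝓡 4) γ 0) = 0 := by
        rintro x rfl
        exact hγ.isNull_velocity.1
      exact key _ hγ0.symm
    have key : ∀ (p : Kerr.region a r₁) (_ : p = j (𝒦.embed y)), Kerr.bilin M a (p : E4)
        (mfderiv (𝓡 4) 𝓘(ℝ, E4) j (𝒦.embed y) (velocity (𝓡 4) γ 0))
        (mfderiv (𝓡 4) 𝓘(ℝ, E4) j (𝒦.embed y) (velocity (𝓡 4) γ 0)) = 0 := by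
      rintro p rfl
      exact h0
    exact key _ hjy.symm
  have hLne : mfderiv (𝓡 4) 𝓘(ℝ, E4) j (𝒦.embed y) (velocity (𝓡 4) γ 0) ≠ 0 := by
    intro h
    apply hγ.isNull_velocity.2
    apply hj' (𝒦.embed y)
    rw [h]
    exact (map_zero _).symm
  have hLfd : ((Kerr.timeOrientation M a r₁ hM).ofLE le_top :
      TimeOrientation (Kerr.smoothMetric M a r₁)).IsFutureDirected (x := graph M a r₁ y)
      (mfderiv (𝓡 4) 𝓘(ℝ, E4) j (𝒦.embed y) (velocity (𝓡 4) γ 0)) := by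
    have h1 : 𝒦.timeOrientation.IsFutureDirected (x := 𝒦.embed y) (velocity (𝓡 4) γ 0) := by
      have key : ∀ (x : 𝒦.carrier) (_ : x = γ 0), 𝒦.timeOrientation.IsFutureDirected (x := x)
          (show TangentSpace (𝓡 4) x from velocity (𝓡 4) γ 0) := by
        rintro x rfl
        exact hγ.isFutureDirected_velocity
      exact key _ hγ0.symm
    have h2 := hτ.isFutureDirected_mfderiv hiso.2 h1
    have key : ∀ (p : Kerr.region a r₁) (_ : p = j (𝒦.embed y)),
        ((Kerr.timeOrientation M a r₁ hM).ofLE le_top :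
          TimeOrientation (Kerr.smoothMetric M a r₁)).IsFutureDirected (x := p)
          (show TangentSpace 𝓘(ℝ, E4) p from
            mfderiv (𝓡 4) 𝓘(ℝ, E4) j (𝒦.embed y) (velocity (𝓡 4) γ 0)) := by
      rintro p rfl
      exact h2
    exact key _ hjy.symm
  have hLnorm : Kerr.bilin M a (graph M a r₁ y)
      (mfderiv (𝓡 4) 𝓘(ℝ, E4) j (𝒦.embed y) (velocity (𝓡 4) γ 0)) (ν y) = -1 := by
    have h0 : (Kerr.smoothMetric M a r₁).val (j (𝒦.embed y))
        (mfderiv (𝓡 4) 𝓘(ℝ, E4) j (𝒦.embed y) (velocity (𝓡 4) γ 0))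
        (mfderiv (𝓡 4) 𝓘(ℝ, E4) j (𝒦.embed y) (𝒦.normal y)) = -1 := by
      rw [← hval]
      exact hγ.val_velocity_normal
    have key : ∀ (p : Kerr.region a r₁) (_ : p = j (𝒦.embed y)), Kerr.bilin M a (p : E4)
        (mfderiv (𝓡 4) 𝓘(ℝ, E4) j (𝒦.embed y) (velocity (𝓡 4) γ 0))
        (mfderiv (𝓡 4) 𝓘(ℝ, E4) j (𝒦.embed y) (𝒦.normal y)) = -1 := by
      rintro p rfl
      exact h0
    have h1 := key _ hjy.symm
    rwa [hjν y] at h1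
  -- so the chart geodesic is a normalised null ray from `y`, to which the optics apply
  have hrayK : (Kerr.smoothMetric M a r₁).IsNormalisedNullRayFrom
      ((Kerr.timeOrientation M a r₁ hM).ofLE le_top) (graph M a r₁) ν y γK domK := by
    refine ⟨hKmax, h0K, hK0, ⟨?_, ?_⟩, ?_, ?_⟩
    · change Kerr.bilin M a (γK 0 : E4) (velocity 𝓘(ℝ, E4) γK 0) (velocity 𝓘(ℝ, E4) γK 0) = 0
      rw [hKv, hK0]
      exact hLnull
    · rw [hKv]; exact hLne
    · have key : ∀ (p : Kerr.region a r₁) (_ : p = graph M a r₁ y) (u : E4)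
          (_ : u = mfderiv (𝓡 4) 𝓘(ℝ, E4) j (𝒦.embed y) (velocity (𝓡 4) γ 0)),
          ((Kerr.timeOrientation M a r₁ hM).ofLE le_top :
            TimeOrientation (Kerr.smoothMetric M a r₁)).IsFutureDirected (x := p)
            (show TangentSpace 𝓘(ℝ, E4) p from u) := by
        rintro p rfl u rfl
        exact hLfd
      exact key _ hK0 _ hKv
    · change Kerr.bilin M a (graph M a r₁ y : E4) (velocity 𝓘(ℝ, E4) γK 0) (ν y) = -1
      rw [hKv]
      exact hLnorm
  -- the chart ray is a future causal curve (energy `E > 0` from the far leaf) issuing from the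
  -- leaf, hence stays in the collar, inside `range j`, for `t ≥ 0`
  have hKoc : domK.OrdConnected := hKmax.2.1
  have hv0K : (velocity 𝓘(ℝ, E4) γK 0 : E4) = deriv (fun σ ↦ (γK σ : E4)) 0 :=
    CollarCauchy.velocity_eq_deriv γK 0
  have hnullK : Kerr.bilin M a (γK 0) (deriv (fun σ ↦ (γK σ : E4)) 0)
      (deriv (fun σ ↦ (γK σ : E4)) 0) = 0 := by
    have h : Kerr.bilin M a (γK 0) (velocity 𝓘(ℝ, E4) γK 0) (velocity 𝓘(ℝ, E4) γK 0) = 0 :=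
      hrayK.isNull_velocity.1
    rwa [hv0K] at h
  have hfdK : 0 < deriv (fun σ ↦ (γK σ : E4)) 0 0 := by
    have h : Kerr.bilin M a (γK 0) (Kerr.timeVector M a (γK 0)) (velocity 𝓘(ℝ, E4) γK 0) < 0 :=
      hrayK.isFutureDirected_velocity.2
    rw [Kerr.bilin_timeVector (Kerr.radius_pos_of_mem_region (γK 0).2), hv0K] at h
    linarith
  have hnormK : Kerr.bilin M a (graph M a r₁ y) (deriv (fun σ ↦ (γK σ : E4)) 0) (ν y) = -1 := by
    have h : Kerr.bilin M a (graph M a r₁ y) (velocity 𝓘(ℝ, E4) γK 0) (ν y) = -1 :=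
      hrayK.val_velocity_normal
    rwa [hv0K] at h
  obtain ⟨hE, -⟩ := KerrLeafSojourn.energy_pos_le_five ha hM hν y hy16
    (by rw [← hK0]; exact hnullK) hfdK hnormK
  rw [← hK0] at hE
  have hE0 : Kerr.bilin M a (γK 0) (deriv (fun σ ↦ (γK σ : E4)) 0) (E4.basisVector 0) ≠ 0 := by
    intro h; rw [h] at hE; simp at hE
  have hKc : (Kerr.smoothMetric M a r₁).IsFutureCausalCurveOn
      ((Kerr.timeOrientation M a r₁ hM).ofLE le_top) γK domK :=
    KerrLeafSojourn.ray_isFutureCausalCurveOn hM hKmax.isOpen hKoc hKmax.isGeodesicOn h0K hnullK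
      hfdK hE0 subset_rfl
  have huK0 : bentHeight M a (Kerr.radius a (γK 0)) ≤ (γK 0 : E4) 0 := by
    rw [hK0]; exact bentHeight_le_graph_zero M a r₁ y
  have hKrange : ∀ t ∈ domK, 0 ≤ t → γK t ∈ range j := fun t ht ht0 ↦
    hW (ScriTransport.curve_mem_collar ha hKoc hKc h0K huK0 ht ht0)
  -- hence the forward piece of the chart ray lies in `dom`: local lifts exist everywhere
  have hcover : ∀ t ∈ domK, 0 ≤ t → t ∈ dom := fun t ht ht0 ↦ by
    rw [hdd]
    refine hmax'.mem_of_forall_exists_lift hjinj hKoc h0' hdom' hagree' (fun b hb hbr ↦ ?_) ht ht0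
      fun t' ht' ↦ hKrange t' (hKoc.out h0K ht ⟨ht'.1, ht'.2⟩) ht'.1
    obtain ⟨p, hp⟩ := hbr
    have h0b : (0 : ℝ) ∈ {u : ℝ | u + b ∈ domK} := by
      show 0 + b ∈ domK
      rw [zero_add]; exact hb
    have hq : j p = (fun u ↦ γK (u - (-b))) 0 := by
      show j p = γK (0 - (-b))
      rw [hp]; congr 1; ring
    have hw : mfderiv (𝓡 4) 𝓘(ℝ, E4) j p
        ((mfderivEquivOfInjective (I := 𝓘(ℝ, E4)) (I' := 𝓡 4) j p (hj' p) hdim).symm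
          (show TangentSpace 𝓘(ℝ, E4) (j p) from velocity 𝓘(ℝ, E4) (fun u ↦ γK (u - (-b))) 0)) =
        velocity 𝓘(ℝ, E4) (fun u ↦ γK (u - (-b))) 0 :=
      mfderiv_mfderivEquivOfInjective_symm j p (hj' p) hdim _
    obtain ⟨β, Dβ, hβmax, h0β, -, -, -, hβagree⟩ :=
      exists_isMaximalGeodesicOn_lift (g := (Kerr.smoothMetric M a r₁).toPseudoRiemannianMetric)
        (g' := 𝒦.metric.toPseudoRiemannianMetric) hj1 hj' hdim hiso.2 (hKmax.comp_add b) h0b hq hw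
    refine ⟨β, Dβ, hβmax.isOpen, hβmax.2.1, h0β, hβmax.isGeodesicOn, fun u hu ↦ ?_⟩
    rw [hβagree u hu]
    show γK (u - (-b)) = γK (u + b)
    rw [sub_neg_eq_add]
  -- conclusion: completeness ascends, sojourn sets ascend
  rcases hR₁ y hyR₁ γK domK hrayK with hK | hK
  · refine Or.inl fun hb ↦ ?_
    obtain ⟨B, hB⟩ := hb
    have h1 : max B 0 + 1 ∈ dom :=
      hcover _ (hK (show (0 : ℝ) ≤ max B 0 + 1 by positivity)) (by positivity)
    have h2 := hB h1
    linarith [le_max_left B 0]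
  · refine Or.inr (hK.trans (MeasureTheory.measure_mono fun t ht ↦ ?_))
    obtain ⟨htK, ht0, hJ⟩ := ht
    have htd : t ∈ dom := hcover t htK ht0
    refine ⟨htd, ht0, ?_⟩
    have hjt : j (γ t) = γK t := hagree t htd
    -- `J⁺_chart(ψ S) ∩ range j` pulls back to `J⁺_𝒦(ι_𝒦 S)`: connecting causal curves from the
    -- leaf stay in the collar (the clock `u`), inside `range j`
    generalize {y' : Kerr.slice a r₁ | Kerr.radius a (E4.ofTimeSpace 0 (y' : E3)) ≤ R₀} = S at hJ ⊢
    have hS : graph M a r₁ '' S = j '' (𝒦.embed '' S) := by rw [← image_comp, hjι]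
    rw [hS] at hJ
    have hstay : ∀ (c : ℝ → Kerr.region a r₁) (a' b' : ℝ), a' < b' →
        (Kerr.smoothMetric M a r₁).IsFutureCausalCurveOn
          ((Kerr.timeOrientation M a r₁ hM).ofLE le_top) c (Icc a' b') →
        c a' ∈ j '' (𝒦.embed '' S) → ∀ σ ∈ Icc a' b', c σ ∈ range j := by
      rintro c a' b' hab hc ⟨x, ⟨y', -, rfl⟩, hca⟩ σ hσ
      have hu0 : bentHeight M a (Kerr.radius a (c a')) ≤ (c a' : E4) 0 := by
        rw [← hca, show j (𝒦.embed y') = graph M a r₁ y' from congrFun hjι y']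
        exact bentHeight_le_graph_zero M a r₁ y'
      exact hW (ScriTransport.curve_mem_collar ha ordConnected_Icc hc (left_mem_Icc.2 hab.le) hu0 hσ
        hσ.1)
    have h := LorentzianMetric.invFun_mem_causalFuture hiso hτ hjinj hloc hstay hJ ⟨γ t, hjt⟩
    rwa [← hjt, Function.leftInverse_invFun hjinj] at h

end Summit.FinalStateConjecture.FinalStateConjecture.Theorems.PhaseMixingCapture.WeakCosmicCensorshipMGHD

end
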